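import Summits.CriticalPhenomena.PercolationContinuityZ3.Theorems.PercNearOneGluingAdditiveGluingFullTieReduction
import HarnessLib

/-!
# Crux `PercNearOneGluing.AdditiveGluing` (stmt-CriticalPhenomena-4576): the relay-gluing RAISE step
# (raise the weight of a pair `{a, y}` of relays at the minimiser `a`; Kozma–Nitzan Lemma 4 pays for the observer)

Support file (`--supports stmt-CriticalPhenomena-4576`, lead prim-png-lead-4576).  No definitions, no named facts, no sorries.

Setting: weighting `w`, relay set `A`, target `b`, observer `o`, `τ(x) = μ_w(x↔b)`, `a ∈ A` a minimiser of `τ` on `A`, `y ∈ A`,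
`e = s(y, a)`.  Along `s ↦ w[e ↦ s]` (from `w e` upwards) every probability is affine (`real_update_affine`); the observer's
reach `μ_s(o↔A)` is constant (the pair lies inside `A`), `τ_s(a)` increases, and by Kozma–Nitzan's Lemma 4 (landed
`knLemma4_pair_glued`, here through `fullTie_gain_obs_le`) `μ_s(o↔b) − μ_w(o↔b) ≤ τ_s(a) − τ_w(a)`.  Hence the additive margin
`μ(o↔A) − (1 − τ(a)) − μ(o↔b)` can only grow along the path: the crux inequality at `w` follows from the crux inequality at any
`w[e ↦ s]` at which `a` is still a minimiser, with the slack lowered by `τ_s(a) − τ_w(a)`.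

**`tripleTie_raise`** packages one such move up to the FIRST event: either some relay that was strictly above `a` comes down to a
tie with `a` (a "catch"), or the pair is glued (`s = 1`, then `τ(y) = τ(a)`) with every previously-strict relay still strictly above.
It is the engine of `PercNearOneGluingAdditiveGluingTripleTieReduction` (the crux at the tie locus reduces to instances with a
TRIPLE tie at the minimum).  [cite: KozmaNitzan2024, Lemma 4 / eq. (9) (pp. 9–10), §5.3 (p. 34)]
-/

namespace Summit.CriticalPhenomena.PercolationContinuityZ3.Theorems

open MeasureTheory Set Literature.Probability.LatticeModels Literature.Probability.Percolation

noncomputable section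
open Classical

variable {n : ℕ}

/-- A weight-`1` pair ties its endpoints: `w s(y,a) = 1`, `y ≠ a` ⇒ `μ_w(y↔x) = μ_w(a↔x)`. [folklore] -/
theorem tripleTie_tau_eq_of_weight_one (w : Sym2 (Fin n) → unitInterval) {y a : Fin n} (hya : y ≠ a)
    (h1 : w s(y, a) = 1) (x : Fin n) :
    (prodBernoulli w).real (openConn y x) = (prodBernoulli w).real (openConn a x) := by
  have hw : Function.update w s(y, a) 1 = w := by rw [← h1, Function.update_eq_self]
  have hy := fullTie_tau1_one w hya x
  have ha := fullTie_tau3_one w hya x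
  rw [hw] at hy ha
  rw [hy, ha]

/-- The observer's reach of the relay set is unchanged by gluing a pair of relays. [folklore] -/
theorem tripleTie_reachA_one (w : Sym2 (Fin n) → unitInterval) (A : Finset (Fin n)) {y a : Fin n} (hya : y ≠ a)
    (hy : y ∈ A) (ha : a ∈ A) (o : Fin n) :
    (prodBernoulli (Function.update w s(y, a) 1)).real (⋃ c ∈ A, openConn o c) =
      (prodBernoulli w).real (⋃ c ∈ A, openConn o c : Set (BondConfig (Fin n))) := by
  rw [fullTie_real_update_one w hya]
  congr 1
  ext ω
  simp only [Set.mem_setOf_eq, Set.mem_iUnion, exists_prop]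
  constructor
  · rintro ⟨c, hc, h⟩
    rcases (fullTie_glueReach_pair y a ω o c).1 h with h | ⟨hl | hl, -⟩
    · exact ⟨c, hc, h⟩
    · exact ⟨y, hy, hl⟩
    · exact ⟨a, ha, hl⟩
  · rintro ⟨c, hc, h⟩
    exact ⟨c, hc, (fullTie_glueReach_pair y a ω o c).2 (Or.inl h)⟩

/-- **The raise step.**  Let `a ∈ A` minimise `τ = μ_w(·↔b)` on `A`, `y ∈ A`, `y ≠ a`, and suppose every relay is `a`, `y`,
strictly above `a`, or glued to `a` by a weight-`1` pair.  Then there is a weighting `w'`, equal to `w` off the pair `s(y,a)`, with: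
`a` still a minimiser; `τ_{w'}(y) − τ_{w'}(a) ≤ τ_w(y) − τ_w(a)`; the observer's reach of `A` unchanged and its gain at most `a`'s
gain `Δ = τ_{w'}(a) − τ_w(a) ≥ 0` (Kozma–Nitzan Lemma 4); and EITHER a catch (some relay strictly above `a` in `w` ties with `a` in
`w'`) OR the glued end (`w' s(y,a) = 1`, `τ_{w'}(y) = τ_{w'}(a)`, every previously-strict relay still strictly above).
[cite: KozmaNitzan2024, Lemma 4 / eq. (9) (pp. 9–10), §5.3 (p. 34)] -/
theorem tripleTie_raise (w : Sym2 (Fin n) → unitInterval) (A : Finset (Fin n)) (o b a y : Fin n)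
    (ha : a ∈ A) (hy : y ∈ A) (hya : y ≠ a)
    (hmin : ∀ c ∈ A, (prodBernoulli w).real (openConn a b) ≤ (prodBernoulli w).real (openConn c b))
    (hsplit : ∀ c ∈ A, (prodBernoulli w).real (openConn a b) < (prodBernoulli w).real (openConn c b) ∨ c = a ∨ c = y ∨
      (c ≠ a ∧ w s(c, a) = 1)) :
    ∃ w' : Sym2 (Fin n) → unitInterval,
      (∀ e', e' ≠ s(y, a) → w' e' = w e') ∧
      (∀ c ∈ A, (prodBernoulli w').real (openConn a b) ≤ (prodBernoulli w').real (openConn c b)) ∧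
      ((prodBernoulli w').real (openConn y b) - (prodBernoulli w').real (openConn a b) ≤
        (prodBernoulli w).real (openConn y b) - (prodBernoulli w).real (openConn a b)) ∧
      (prodBernoulli w).real (openConn a b) ≤ (prodBernoulli w').real (openConn a b) ∧
      (prodBernoulli w').real (⋃ c ∈ A, openConn o c) = (prodBernoulli w).real (⋃ c ∈ A, openConn o c) ∧
      ((prodBernoulli w').real (openConn o b) - (prodBernoulli w).real (openConn o b) ≤
        (prodBernoulli w').real (openConn a b) - (prodBernoulli w).real (openConn a b)) ∧
      ((∃ d ∈ A, (prodBernoulli w).real (openConn a b) < (prodBernoulli w).real (openConn d b) ∧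
          (prodBernoulli w').real (openConn d b) = (prodBernoulli w').real (openConn a b)) ∨
        (w' s(y, a) = 1 ∧ (prodBernoulli w').real (openConn y b) = (prodBernoulli w').real (openConn a b) ∧
          ∀ c ∈ A, (prodBernoulli w).real (openConn a b) < (prodBernoulli w).real (openConn c b) →
            (prodBernoulli w').real (openConn a b) < (prodBernoulli w').real (openConn c b))) := by
  -- the pair, the glued weighting and the affine parametrisation
  set e : Sym2 (Fin n) := s(y, a) with he
  set w1 : Sym2 (Fin n) → unitInterval := Function.update w e 1 with hw1
  set w0 : Sym2 (Fin n) → unitInterval := Function.update w e 0 with hw0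
  let P0 : Set (BondConfig (Fin n)) → ℝ := fun S => (prodBernoulli w0).real S
  let P1 : Set (BondConfig (Fin n)) → ℝ := fun S => (prodBernoulli w1).real S
  have hL : ∀ (S : Set (BondConfig (Fin n))) (s : ℝ), s ∈ Set.Icc (0:ℝ) 1 →
      (prodBernoulli (Function.update w e (Set.projIcc (0:ℝ) 1 zero_le_one s))).real S = P0 S + s * (P1 S - P0 S) :=
    fun S s hs => real_update_affine w e S hs
  have hwe : Function.update w e (Set.projIcc (0:ℝ) 1 zero_le_one (w e : ℝ)) = w := by
    have : Set.projIcc (0:ℝ) 1 zero_le_one (w e : ℝ) = w e := by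
      rw [Set.projIcc_of_mem _ ⟨(w e).2.1, (w e).2.2⟩]
    rw [this, Function.update_eq_self]
  have hwe_mem : ((w e : ℝ)) ∈ Set.Icc (0:ℝ) 1 := ⟨(w e).2.1, (w e).2.2⟩
  set q : ℝ := (w e : ℝ) with hq
  have hPq : ∀ S : Set (BondConfig (Fin n)), (prodBernoulli w).real S = P0 S + q * (P1 S - P0 S) := by
    intro S
    have := hL S q hwe_mem
    rwa [hwe] at this
  -- interpolated weighting for a parameter `lam ∈ [0,1]` between `w` (lam = 0) and `w1` (lam = 1)
  have hinterp : ∀ lam : ℝ, 0 ≤ lam → lam ≤ 1 →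
      (q + lam * (1 - q)) ∈ Set.Icc (0:ℝ) 1 ∧
      ∀ S : Set (BondConfig (Fin n)),
        (prodBernoulli (Function.update w e (Set.projIcc (0:ℝ) 1 zero_le_one (q + lam * (1 - q))))).real S =
          (prodBernoulli w).real S + lam * ((prodBernoulli w1).real S - (prodBernoulli w).real S) := by
    intro lam h0 h1
    have hr : (q + lam * (1 - q)) ∈ Set.Icc (0:ℝ) 1 := by
      constructor
      · nlinarith [hwe_mem.1, hwe_mem.2]
      · nlinarith [hwe_mem.1, hwe_mem.2]
    refine ⟨hr, fun S => ?_⟩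
    rw [hL S _ hr, hPq S]
    show P0 S + (q + lam * (1 - q)) * (P1 S - P0 S) = P0 S + q * (P1 S - P0 S) + lam * (P1 S - (P0 S + q * (P1 S - P0 S)))
    ring
  -- glued values
  have hT1a : (prodBernoulli w1).real (openConn a b) = (prodBernoulli w).real (openConn y b ∪ openConn a b) :=
    fullTie_tau3_one w hya b
  have hT1y : (prodBernoulli w1).real (openConn y b) = (prodBernoulli w).real (openConn y b ∪ openConn a b) :=
    fullTie_tau1_one w hya b
  have hOA1 : (prodBernoulli w1).real (⋃ c ∈ A, openConn o c) = (prodBernoulli w).real (⋃ c ∈ A, openConn o c) :=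
    tripleTie_reachA_one w A hya hy ha o
  have hay : (prodBernoulli w).real (openConn a b) ≤ (prodBernoulli w).real (openConn y b) := hmin y hy
  have hgain : (prodBernoulli w1).real (openConn o b) - (prodBernoulli w).real (openConn o b) ≤
      (prodBernoulli w1).real (openConn a b) - (prodBernoulli w).real (openConn a b) :=
    fullTie_gain_obs_le w hya o b hay
  have hΔ1 : (prodBernoulli w).real (openConn a b) ≤ (prodBernoulli w1).real (openConn a b) := by
    rw [hT1a]; exact measureReal_mono Set.subset_union_right (measure_ne_top _ _)
  -- glued pairs stay glued
  have hglued : ∀ (w' : Sym2 (Fin n) → unitInterval), (∀ e', e' ≠ s(y, a) → w' e' = w e') →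
      ∀ c ∈ A, c ≠ a → w s(c, a) = 1 → c ≠ y →
        (prodBernoulli w').real (openConn c b) = (prodBernoulli w').real (openConn a b) := by
    intro w' hw' c _ hca hc1 hcy
    have hne : s(c, a) ≠ s(y, a) := by
      rw [Ne, Sym2.eq_iff]
      push Not
      exact ⟨fun h _ => hcy h, fun h => absurd h hca⟩
    have h1' : w' s(c, a) = 1 := by rw [hw' _ hne, hc1]
    exact tripleTie_tau_eq_of_weight_one w' hca h1' b
  -- the strictly-above relays and those that would be overtaken at `s = 1`
  set C : Finset (Fin n) := A.filter (fun c => (prodBernoulli w).real (openConn a b) < (prodBernoulli w).real (openConn c b))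
    with hC
  set Cneg : Finset (Fin n) := C.filter (fun c => (prodBernoulli w1).real (openConn c b) < (prodBernoulli w1).real (openConn a b))
    with hCneg
  by_cases hne : Cneg.Nonempty
  · -- a catch happens before `s = 1`: take the first one
    -- root parameter of `c`: lam_c = Gq / (Gq - G1) with Gq = τ(c) - τ(a) > 0 > G1 = τ₁(c) - τ₁(a)
    let root : Fin n → ℝ := fun c =>
      ((prodBernoulli w).real (openConn c b) - (prodBernoulli w).real (openConn a b)) /
        (((prodBernoulli w).real (openConn c b) - (prodBernoulli w).real (openConn a b)) -
          ((prodBernoulli w1).real (openConn c b) - (prodBernoulli w1).real (openConn a b)))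
    obtain ⟨cs, hcs, hcsmin⟩ := Finset.exists_min_image Cneg root hne
    have hcsC : cs ∈ C := (Finset.mem_filter.1 hcs).1
    have hcsA : cs ∈ A := (Finset.mem_filter.1 hcsC).1
    have hGq : 0 < (prodBernoulli w).real (openConn cs b) - (prodBernoulli w).real (openConn a b) := by
      have := (Finset.mem_filter.1 hcsC).2; linarith
    have hG1 : (prodBernoulli w1).real (openConn cs b) - (prodBernoulli w1).real (openConn a b) < 0 := by
      have := (Finset.mem_filter.1 hcs).2; linarith
    set lam : ℝ := root cs with hlam
    have hden : 0 < ((prodBernoulli w).real (openConn cs b) - (prodBernoulli w).real (openConn a b)) -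
        ((prodBernoulli w1).real (openConn cs b) - (prodBernoulli w1).real (openConn a b)) := by linarith
    have hlam0 : 0 ≤ lam := div_nonneg hGq.le hden.le
    have hlam1 : lam ≤ 1 := by
      show root cs ≤ 1
      simp only [root]
      rw [div_le_one hden]; linarith
    have hlam_eq : lam * (((prodBernoulli w).real (openConn cs b) - (prodBernoulli w).real (openConn a b)) -
        ((prodBernoulli w1).real (openConn cs b) - (prodBernoulli w1).real (openConn a b))) =
        (prodBernoulli w).real (openConn cs b) - (prodBernoulli w).real (openConn a b) := by
      show root cs * _ = _
      simp only [root]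
      field_simp
    obtain ⟨hr_mem, hPr⟩ := hinterp lam hlam0 hlam1
    set w' : Sym2 (Fin n) → unitInterval := Function.update w e (Set.projIcc (0:ℝ) 1 zero_le_one (q + lam * (1 - q))) with hw'
    have hw'off : ∀ e', e' ≠ s(y, a) → w' e' = w e' := fun e' he' => by
      rw [hw']; exact Function.update_of_ne he' _ _
    have hPa := hPr (openConn a b)
    have hPy := hPr (openConn y b)
    -- minimality of `a` at `w'`
    have hmin' : ∀ c ∈ A, (prodBernoulli w').real (openConn a b) ≤ (prodBernoulli w').real (openConn c b) := by
      intro c hc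
      have hPc := hPr (openConn c b)
      rcases hsplit c hc with hlt | rfl | rfl | ⟨hca, hc1⟩
      · -- strictly above at `w`
        by_cases hneg : (prodBernoulli w1).real (openConn c b) < (prodBernoulli w1).real (openConn a b)
        · -- would be overtaken at `s = 1`: `lam ≤ root c`
          have hcneg : c ∈ Cneg := Finset.mem_filter.2 ⟨Finset.mem_filter.2 ⟨hc, hlt⟩, hneg⟩
          have hle := hcsmin c hcneg
          have hdenc : 0 < ((prodBernoulli w).real (openConn c b) - (prodBernoulli w).real (openConn a b)) -
              ((prodBernoulli w1).real (openConn c b) - (prodBernoulli w1).real (openConn a b)) := by linarith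
          have hle' : lam * (((prodBernoulli w).real (openConn c b) - (prodBernoulli w).real (openConn a b)) -
              ((prodBernoulli w1).real (openConn c b) - (prodBernoulli w1).real (openConn a b))) ≤
              (prodBernoulli w).real (openConn c b) - (prodBernoulli w).real (openConn a b) := by
            have h1 : lam ≤ root c := hle
            have h2 : root c * (((prodBernoulli w).real (openConn c b) - (prodBernoulli w).real (openConn a b)) -
                ((prodBernoulli w1).real (openConn c b) - (prodBernoulli w1).real (openConn a b))) =
                (prodBernoulli w).real (openConn c b) - (prodBernoulli w).real (openConn a b) := by
              simp only [root]; field_simp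
            nlinarith
          rw [hPa, hPc]; nlinarith
        · push Not at hneg
          rw [hPa, hPc]; nlinarith
      · exact le_rfl
      · rw [hPa, hPy, hT1a, hT1y]; nlinarith
      · by_cases hcy : c = y
        · subst hcy; rw [hPa, hPy, hT1a, hT1y]; nlinarith
        · exact le_of_eq (hglued w' hw'off c hc hca hc1 hcy).symm
    refine ⟨w', hw'off, hmin', ?_, ?_, ?_, ?_, Or.inl ⟨cs, hcsA, (Finset.mem_filter.1 hcsC).2, ?_⟩⟩
    · rw [hPa, hPy, hT1a, hT1y]; nlinarith
    · rw [hPa]; nlinarith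
    · rw [hPr, hOA1]; ring
    · rw [hPr (openConn o b), hPa]; nlinarith
    · rw [hPr (openConn cs b), hPa]; linarith
  · -- no relay is overtaken before `s = 1`: glue the pair
    have hCneg0 : ∀ c ∈ C, (prodBernoulli w1).real (openConn a b) ≤ (prodBernoulli w1).real (openConn c b) := by
      intro c hc
      by_contra hlt
      exact hne ⟨c, Finset.mem_filter.2 ⟨hc, lt_of_not_ge hlt⟩⟩
    have hw1off : ∀ e', e' ≠ s(y, a) → w1 e' = w e' := fun e' he' => by
      rw [hw1]; exact Function.update_of_ne he' _ _
    have hmin1 : ∀ c ∈ A, (prodBernoulli w1).real (openConn a b) ≤ (prodBernoulli w1).real (openConn c b) := by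
      intro c hc
      rcases hsplit c hc with hlt | rfl | rfl | ⟨hca, hc1⟩
      · exact hCneg0 c (Finset.mem_filter.2 ⟨hc, hlt⟩)
      · exact le_rfl
      · rw [hT1a, hT1y]
      · by_cases hcy : c = y
        · subst hcy; rw [hT1a, hT1y]
        · exact le_of_eq (hglued w1 hw1off c hc hca hc1 hcy).symm
    by_cases hcatch : ∃ d ∈ A, (prodBernoulli w).real (openConn a b) < (prodBernoulli w).real (openConn d b) ∧
        (prodBernoulli w1).real (openConn d b) = (prodBernoulli w1).real (openConn a b)
    · refine ⟨w1, hw1off, hmin1, ?_, hΔ1, hOA1, hgain, Or.inl hcatch⟩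
      rw [hT1a, hT1y]; linarith
    · push Not at hcatch
      refine ⟨w1, hw1off, hmin1, ?_, hΔ1, hOA1, hgain, Or.inr ⟨?_, ?_, ?_⟩⟩
      · rw [hT1a, hT1y]; linarith
      · rw [hw1]; exact Function.update_self _ _ _
      · rw [hT1a, hT1y]
      · intro c hc hlt
        have hle := hCneg0 c (Finset.mem_filter.2 ⟨hc, hlt⟩)
        exact lt_of_le_of_ne hle (fun h => hcatch c hc hlt h.symm)

end

end Summit.CriticalPhenomena.PercolationContinuityZ3.Theorems
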